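import Summits.CriticalPhenomena.PercolationContinuityZ3.Theorems.PercNearOneGluingNoHeavyQuantFarRelayRowBlockCombStrong
import Summits.CriticalPhenomena.PercolationContinuityZ3.Theorems.PercNearOneGluingNoHeavyQuantBlockCombGeneralRow
import HarnessLib

/-!
# QUANT lane R8: FAR at every layer for EVERY block-comb under FAR's own mean hypothesis — GATE COORDINATES and ROUTE VOCABULARY

builds on p205010 (kernel theorem, internal audit signed; external expert review pending)

Support file (`--supports stmt-CriticalPhenomena-4575`), QUANT lane seat prim-quant-census-1 (gen 13); memo
`run/shared/lean/prim/quant/prim-quant-census-1/GENERAL-ROW-G13.md`.  Theorems only, no sorries, standard axioms.  The transport of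
`Quant.BlockComb.tail_ge_of_mean_le` (`…QuantBlockCombGeneralRow.lean`: the far-relay row for every block-comb in the canonical model)
along p1 g8's identification `Quant.BlockCombGate.real_heavy_eq_tail` and wrapper pattern `Quant.farRelayRow_tree_blockComb_strong`
(`…QuantFarTreeBlockCombStrong.lean`, `…QuantFarRelayRowBlockCombStrong.lean`).

* `Quant.BlockCombGate.farTree_blockComb_of_mean_floor` — **gate coordinates** (renamed 2026-08-21T05:40Z from `farTree_blockComb_of_mean`,
  a fully-qualified name that p1 g9's `…QuantFarRelayRowBlockCombRow.lean` landed concurrently for ITS gate-coordinate row — dedup race;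
  this file's version carries the extra chain-floor hypothesis, hence `_floor`): independent gates `q : E → [0,1]`, chain `ch : Fin D → E`
  (injective), blobs with pairwise disjoint private gate sets `G k` off the chain, levels `lv k ≤ D`, sizes `a k`; if
  `2j < Σ_k a k·(∏_{i<lv k} q (ch i))·∏_{G k} q` (the MEAN of the relay count), `1 − marginal k ≤ t` for every live blob and
  `1 − ∏_{i<D} q (ch i) ≤ t` (the chain floor), then `P(Σ_{k reached} a k ≤ j) ≤ t`.
* `Quant.farRelayRow_tree_blockComb_of_mean` — **route vocabulary: the body of `Quant.FarRelayRow` at EVERY layer for EVERY tree-supported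
  weight carrying a block-comb presentation that covers `A`** (chain `ch`, classes `R k` partitioning `A` with private vertex sets `G k`,
  levels `lv k ≤ D`, some nonempty class at the bottom level `D`, root path of each relay of class `k` = `ch''{i<lv k} ∪ G k`):
  `2j < Σ_{b∈A} P(o ↔ b)` and `P(o ↮ b) ≤ t` on `A` give `P(#{b ∈ A | o ↔ b} ≤ j) ≤ t`.  No strong / tied / class hypothesis.
[cite: KozmaNitzan2024, Lemma 2 (p. 6), Conjecture 3 (p. 15)]; the family theorem is [this work].
-/

noncomputable section

namespace Summit.CriticalPhenomena.PercolationContinuityZ3.Theorems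

namespace Quant

open Finset MeasureTheory
open Literature.Probability.LatticeModels
open Literature.Probability.Percolation
open scoped Classical

namespace BlockCombGate

variable {E : Type*} [Fintype E] [DecidableEq E] {κ : Type*} [Fintype κ] [DecidableEq κ]

/-- product weight of a set of open blobs (canonical model of `…QuantBlockCombMergeModel`) -/
local notation3 "wt[" g ", " S "]" => ∏ k, (if k ∈ (S : Finset κ) then (g : κ → ℝ) k else 1 - (g : κ → ℝ) k)
/-- depth law of the chain -/
local notation3 "pd[" D ", " q ", " i "]" =>
  (∏ i' ∈ Finset.range (i : ℕ), (q : ℕ → ℝ) i') * (if (i : ℕ) < (D : ℕ) then 1 - (q : ℕ → ℝ) i else 1)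
/-- mass counted at depth `i` -/
local notation3 "mass[" lv ", " a ", " i ", " S "]" =>
  ∑ k ∈ (S : Finset κ).filter (fun k => (lv : κ → ℕ) k ≤ (i : ℕ)), ((a : κ → ℕ) k : ℕ)
/-- the canonical tail -/
local notation3 "TAIL[" D ", " q ", " lv ", " a ", " g ", " j "]" =>
  ∑ i ∈ Finset.range ((D : ℕ) + 1), pd[D, q, i] *
    ∑ S : Finset κ, wt[g, S] * (if (j : ℕ) + 1 ≤ mass[lv, a, i, S] then (1 : ℝ) else 0)

/-- **FAR at every layer for every block-comb, gate coordinates (mean hypothesis).**  Independent gates `q`, an injective chain `ch`,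
pairwise disjoint private gate sets `G k` off the chain, levels `lv k ≤ D`, sizes `a k`.  If `2j <` the mean
`Σ_k a k·(∏_{i<lv k} q (ch i))·∏_{e∈G k} q e`, every live blob has `1 − marginal ≤ t`, and the chain floor satisfies
`1 − ∏_{i<D} q (ch i) ≤ t`, then `P(Σ_{k reached} a k ≤ j) ≤ t`. [this work] -/
theorem farTree_blockComb_of_mean_floor (q : E → unitInterval) (D : ℕ) (ch : Fin D → E) (hch : Function.Injective ch)
    (G : κ → Finset E) (hGdisj : ∀ k k', k ≠ k' → Disjoint (G k) (G k')) (hGch : ∀ k (i : Fin D), ch i ∉ G k)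
    (lv : κ → ℕ) (hlv : ∀ k, lv k ≤ D) (a : κ → ℕ) (j : ℕ) (t : ℝ)
    (hbudget : (2 * j : ℝ) < ∑ k, (a k : ℝ) *
      ((∏ i ∈ Finset.range (lv k), (if h : i < D then ((q (ch ⟨i, h⟩) : unitInterval) : ℝ) else 1)) *
        ∏ e ∈ G k, (q e : ℝ)))
    (ht : ∀ k, 0 < a k →
      1 - (∏ i ∈ Finset.range (lv k), (if h : i < D then ((q (ch ⟨i, h⟩) : unitInterval) : ℝ) else 1)) *
        ∏ e ∈ G k, (q e : ℝ) ≤ t)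
    (htD : 1 - (∏ i ∈ Finset.range D, (if h : i < D then ((q (ch ⟨i, h⟩) : unitInterval) : ℝ) else 1)) ≤ t) :
    (prodBernoulli q).real {ω : Set E | ∑ k ∈ Finset.univ.filter
        (fun k => (∀ i : Fin D, (i : ℕ) < lv k → ch i ∈ ω) ∧ ((G k : Finset E) : Set E) ⊆ ω), a k ≤ j} ≤ t := by
  -- trivial when `t ≥ 1`
  by_cases ht1 : 1 ≤ t
  · exact le_trans (measureReal_le_one) ht1
  push Not at ht1
  set H : Set (Set E) := {ω : Set E | j + 1 ≤ ∑ k ∈ Finset.univ.filter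
        (fun k => (∀ i : Fin D, (i : ℕ) < lv k → ch i ∈ ω) ∧ ((G k : Finset E) : Set E) ⊆ ω), a k} with hH
  have hcompl : {ω : Set E | ∑ k ∈ Finset.univ.filter
        (fun k => (∀ i : Fin D, (i : ℕ) < lv k → ch i ∈ ω) ∧ ((G k : Finset E) : Set E) ⊆ ω), a k ≤ j} = Hᶜ := by
    ext ω; simp only [hH, Set.mem_setOf_eq, Set.mem_compl_iff, not_le]; omega
  have hheavy : (prodBernoulli q).real H =
      TAIL[D, (fun i => if h : i < D then ((q (ch ⟨i, h⟩) : unitInterval) : ℝ) else 1), lv, a,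
        (fun k => ∏ e ∈ G k, (q e : ℝ)), j] :=
    real_heavy_eq_tail D q ch hch G hGdisj hGch lv hlv a j
  rw [hcompl, probReal_compl_eq_one_sub MeasurableSet.of_discrete, hheavy]
  set qc : ℕ → ℝ := fun i => if h : i < D then ((q (ch ⟨i, h⟩) : unitInterval) : ℝ) else 1 with hqc
  set g : κ → ℝ := fun k => ∏ e ∈ G k, (q e : ℝ) with hg
  have hqc01 : ∀ i, 0 ≤ qc i ∧ qc i ≤ 1 := fun i => by
    by_cases h : i < D
    · simp only [hqc, dif_pos h]; exact ⟨(q _).2.1, (q _).2.2⟩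
    · simp only [hqc, dif_neg h]; norm_num
  have hg01 : ∀ k, 0 ≤ g k ∧ g k ≤ 1 := fun k =>
    ⟨Finset.prod_nonneg fun e _ => (q e).2.1, Finset.prod_le_one (fun e _ => (q e).2.1) fun e _ => (q e).2.2⟩
  have hx : ∀ k, 0 < a k → 1 - t ≤ (∏ i ∈ Finset.range (lv k), qc i) * g k := fun k hk => by have := ht k hk; linarith
  have hxD : 1 - t ≤ ∏ i ∈ Finset.range D, qc i := by linarith
  have key := BlockComb.tail_ge_of_mean_le D qc hqc01 lv a g hg01 j (fun k _ => hlv k) (1 - t) (by linarith) hxD hx hbudget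
  linarith

end BlockCombGate

variable {n : ℕ}

/-- **FAR at every layer for EVERY block-comb, route vocabulary, under FAR's own hypothesis.**  Tree-supported weights `w` on
`Sym2 (Fin n)` (root `o`, coordinates `par`/`depth`, `hsupp`), relays `A ∌ o`, and a block-comb presentation (`ch`, `R`, `G`, `lv`) COVERING
`A`: chain `ch` (injective), classes `R k ⊆ A` pairwise disjoint with `A = ⋃ R k`, private vertex sets `G k ∌ o` pairwise disjoint and off
the chain, `lv k ≤ D` with some nonempty class at level `D`, and for every `b ∈ R k` the root path `{par^[i] b | i ≤ depth b}` equals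
`ch''{i < lv k} ∪ G k`.  If `2j < Σ_{b∈A} P(o ↔ b)` and `P(o ↮ b) ≤ t` for all `b ∈ A`, then `P(#{b ∈ A | o ↔ b} ≤ j) ≤ t` — the body of
`Quant.FarRelayRow` for this family, with no strong / tied / class hypothesis (`Quant.BlockComb.tail_ge_of_mean`). [this work] -/
theorem farRelayRow_tree_blockComb_of_mean (n : ℕ) (w : Sym2 (Fin n) → unitInterval) (o : Fin n)
    (depth : Fin n → ℕ) (par : Fin n → Fin n)
    (hroot : ∀ x, x ≠ o → depth x = 0 → par x = o)
    (hstep : ∀ x, x ≠ o → depth x ≠ 0 → par x ≠ o ∧ depth (par x) + 1 = depth x)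
    (hsupp : ∀ e, w e ≠ 0 → e.IsDiag ∨ ∃ x, x ≠ o ∧ e = s(par x, x))
    (A : Finset (Fin n)) (hoA : o ∉ A) (j : ℕ) (t : ℝ)
    {κ : Type*} [Fintype κ] [DecidableEq κ]
    (D : ℕ) (ch : Fin D → Fin n) (hch : Function.Injective ch)
    (G : κ → Finset (Fin n)) (hGdisj : ∀ k k', k ≠ k' → Disjoint (G k) (G k')) (hGch : ∀ k (i : Fin D), ch i ∉ G k)
    (hGo : ∀ k, o ∉ G k)
    (R : κ → Finset (Fin n)) (hRA : ∀ k, R k ⊆ A) (hRdisj : ∀ k k', k ≠ k' → Disjoint (R k) (R k'))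
    (hcover : ∀ b ∈ A, ∃ k, b ∈ R k)
    (lv : κ → ℕ) (hlv : ∀ k, lv k ≤ D) (hdeep : ∃ k, (R k).Nonempty ∧ lv k = D)
    (hpath : ∀ k, ∀ b ∈ R k, (Finset.range (depth b + 1)).image (fun i => par^[i] b) =
      ((Finset.univ : Finset (Fin D)).filter (fun i : Fin D => i.val < lv k)).image ch ∪ G k)
    (hEN : (2 * j : ℝ) < ∑ b ∈ A, (prodBernoulli w).real (openConn o b))
    (ht : ∀ b ∈ A, (prodBernoulli w).real (openConn o b : Set (BondConfig (Fin n)))ᶜ ≤ t) :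
    (prodBernoulli w).real {ω : BondConfig (Fin n) | (A.filter fun b => ω ∈ openConn o b).card ≤ j} ≤ t := by
  rw [tree_relayCount_transfer n w o depth par hroot hstep hsupp A j]
  set q : Fin n → unitInterval := fun x => if x = o then 1 else w s(par x, x) with hq
  have hqy : ∀ y, y ≠ o → q y = w s(par y, y) := fun y hy => by simp only [hq, if_neg hy]
  have hAo : ∀ b ∈ A, b ≠ o := fun b hb hbo => hoA (hbo ▸ hb)
  -- the reached-class event contains the light relay-count event
  set F : Set (Set (Fin n)) := {ω' : Set (Fin n) | ∑ k ∈ Finset.univ.filter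
      (fun k => (∀ i : Fin D, (i : ℕ) < lv k → ch i ∈ ω') ∧ ((G k : Finset (Fin n)) : Set (Fin n)) ⊆ ω'), (R k).card ≤ j} with hF
  have hsub : {ω' : Set (Fin n) | (A.filter fun a => a = o ∨ ∀ i, i ≤ depth a → par^[i] a ∈ ω').card ≤ j} ⊆ F := by
    intro ω' hω'
    have hle : (A.filter fun a => a = o ∨ ∀ i, i ≤ depth a → par^[i] a ∈ ω').card ≤ j := hω'
    show ∑ k ∈ Finset.univ.filter
      (fun k => (∀ i : Fin D, (i : ℕ) < lv k → ch i ∈ ω') ∧ ((G k : Finset (Fin n)) : Set (Fin n)) ⊆ ω'), (R k).card ≤ j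
    set Kr : Finset κ := Finset.univ.filter
      (fun k => (∀ i : Fin D, (i : ℕ) < lv k → ch i ∈ ω') ∧ ((G k : Finset (Fin n)) : Set (Fin n)) ⊆ ω') with hKr
    have hreach : ∀ k ∈ Kr, ∀ b ∈ R k, (b = o ∨ ∀ i, i ≤ depth b → par^[i] b ∈ ω') := by
      intro k hk b hb
      obtain ⟨-, hpre, hG⟩ := Finset.mem_filter.1 hk
      refine Or.inr fun i hi => ?_
      have hmem : par^[i] b ∈ (Finset.range (depth b + 1)).image (fun i => par^[i] b) :=
        Finset.mem_image.2 ⟨i, Finset.mem_range.2 (by omega), rfl⟩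
      rw [hpath k b hb, Finset.mem_union] at hmem
      rcases hmem with h | h
      · obtain ⟨i', hi', he⟩ := Finset.mem_image.1 h
        rw [← he]
        exact hpre i' (Finset.mem_filter.1 hi').2
      · exact hG (Finset.mem_coe.2 h)
    have hcard : ∑ k ∈ Kr, (R k).card = (Kr.biUnion R).card := by
      rw [Finset.card_biUnion]
      intro k _ k' _ hkk'
      exact hRdisj k k' hkk'
    have hsubset : Kr.biUnion R ⊆ A.filter fun a => a = o ∨ ∀ i, i ≤ depth a → par^[i] a ∈ ω' := by
      intro b hb
      obtain ⟨k, hk, hbk⟩ := Finset.mem_biUnion.1 hb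
      exact Finset.mem_filter.2 ⟨hRA k hbk, hreach k hk b hbk⟩
    calc ∑ k ∈ Kr, (R k).card = (Kr.biUnion R).card := hcard
      _ ≤ (A.filter fun a => a = o ∨ ∀ i, i ≤ depth a → par^[i] a ∈ ω').card := Finset.card_le_card hsubset
      _ ≤ j := hle
  refine le_trans (measureReal_mono hsub (measure_ne_top _ _)) ?_
  -- the marginal of a relay of class `k` is the canonical marginal of the class
  set qc : ℕ → ℝ := fun i => if h : i < D then ((q (ch ⟨i, h⟩) : unitInterval) : ℝ) else 1 with hqc
  have hqG : ∀ k, ∏ e ∈ G k, (q e : ℝ) = ∏ y ∈ G k, (w s(par y, y) : ℝ) := fun k =>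
    Finset.prod_congr rfl fun y hy => by rw [hqy y (fun h => hGo k (h ▸ hy))]
  have hmargb : ∀ k, ∀ b ∈ R k, (prodBernoulli w).real (openConn o b) =
      (∏ i ∈ Finset.range (lv k), qc i) * ∏ e ∈ G k, (q e : ℝ) := by
    intro k b hb
    have hbA : b ∈ A := hRA k hb
    have hbo : b ≠ o := hAo b hbA
    rw [tree_real_openConn_eq_prod n w o depth par hroot hstep hsupp b hbo]
    have hprod : ∏ i ∈ Finset.range (depth b + 1), (w s(par (par^[i] b), par^[i] b) : ℝ) =
        ∏ y ∈ (Finset.range (depth b + 1)).image (fun i => par^[i] b), (q y : ℝ) := by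
      rw [Finset.prod_image (tree_iterate_injOn o depth par hstep b hbo)]
      refine Finset.prod_congr rfl fun i hi => ?_
      have hne := (tree_iterate_par o depth par hstep b hbo i (by have := Finset.mem_range.1 hi; omega)).1
      rw [hqy _ hne]
    have hdisj : Disjoint (((Finset.univ : Finset (Fin D)).filter (fun i : Fin D => i.val < lv k)).image ch) (G k) := by
      rw [Finset.disjoint_left]
      intro y hy hyG
      obtain ⟨i, -, rfl⟩ := Finset.mem_image.1 hy
      exact hGch k i hyG
    have hrange : ∏ i ∈ Finset.range (lv k), qc i =
        ∏ i ∈ Finset.range D, (if i < lv k then qc i else 1) := by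
      rw [← Finset.prod_filter]
      refine Finset.prod_congr ?_ fun _ _ => rfl
      ext i; simp only [Finset.mem_range, Finset.mem_filter]; have := hlv k; omega
    have hchain : ∏ y ∈ ((Finset.univ : Finset (Fin D)).filter (fun i : Fin D => i.val < lv k)).image ch, (q y : ℝ) =
        ∏ i ∈ Finset.range (lv k), qc i := by
      rw [Finset.prod_image (fun i _ i' _ h => hch h), Finset.prod_filter, hrange,
        ← Fin.prod_univ_eq_prod_range (fun m => if m < lv k then qc m else 1) D]
      refine Finset.prod_congr rfl fun i _ => ?_
      by_cases hi : (i : ℕ) < lv k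
      · rw [if_pos hi, if_pos hi]; simp only [hqc, dif_pos i.2]
      · rw [if_neg hi, if_neg hi]
    rw [hprod, hpath k b hb, Finset.prod_union hdisj, hchain]
  -- marginals below `t`
  have hlive : ∀ k, 0 < (R k).card ↔ (R k).Nonempty := fun k => Finset.card_pos
  have ht' : ∀ k, 0 < (R k).card → 1 - (∏ i ∈ Finset.range (lv k), qc i) * ∏ e ∈ G k, (q e : ℝ) ≤ t := by
    intro k hk
    obtain ⟨b, hb⟩ := (hlive k).1 hk
    have htb := ht b (hRA k hb)
    rw [probReal_compl_eq_one_sub (Set.toFinite _).measurableSet, hmargb k b hb] at htb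
    exact htb
  -- the chain floor below `t`: a nonempty class at the bottom level
  have htD : 1 - (∏ i ∈ Finset.range D, qc i) ≤ t := by
    obtain ⟨k, hk, hkD⟩ := hdeep
    have h := ht' k ((hlive k).2 hk)
    rw [hkD] at h
    have hPle : (∏ i ∈ Finset.range D, qc i) * ∏ e ∈ G k, (q e : ℝ) ≤ ∏ i ∈ Finset.range D, qc i := by
      refine mul_le_of_le_one_right (Finset.prod_nonneg fun i _ => ?_) ?_
      · by_cases hi : i < D
        · simp only [hqc, dif_pos hi]; exact (q _).2.1
        · simp only [hqc, dif_neg hi]; norm_num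
      · exact Finset.prod_le_one (fun e _ => (q e).2.1) fun e _ => (q e).2.2
    linarith
  -- the mean: `Σ_{b∈A} P(o ↔ b) = Σ_k |R k|·marginal k`
  have hmean : ∑ b ∈ A, (prodBernoulli w).real (openConn o b) =
      ∑ k, ((R k).card : ℝ) * ((∏ i ∈ Finset.range (lv k), qc i) * ∏ e ∈ G k, (q e : ℝ)) := by
    have hU : (Finset.univ : Finset κ).biUnion R = A := by
      refine Finset.Subset.antisymm (Finset.biUnion_subset.2 fun k _ => hRA k) fun b hb => ?_
      obtain ⟨k, hk⟩ := hcover b hb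
      exact Finset.mem_biUnion.2 ⟨k, Finset.mem_univ _, hk⟩
    rw [← hU, Finset.sum_biUnion (fun k _ k' _ hkk' => hRdisj k k' hkk')]
    refine Finset.sum_congr rfl fun k _ => ?_
    rw [Finset.sum_congr rfl fun b hb => hmargb k b hb, Finset.sum_const, nsmul_eq_mul]
  have hbudget : (2 * j : ℝ) < ∑ k, ((R k).card : ℝ) *
      ((∏ i ∈ Finset.range (lv k), qc i) * ∏ e ∈ G k, (q e : ℝ)) := by rw [← hmean]; exact hEN
  exact BlockCombGate.farTree_blockComb_of_mean_floor q D ch hch G hGdisj hGch lv hlv (fun k => (R k).card) j t hbudget ht' htD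

end Quant

end Summit.CriticalPhenomena.PercolationContinuityZ3.Theorems
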